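import Summits.SmoothPoincare4.SmoothPoincare4.Theorems.CongruenceShadowsGriffithsHandlebodyExtensionCoverPlanarA
import HarnessLib

/-!
# SmoothPoincare4 / CongruenceShadows — `GriffithsHandlebodyExtension` (item stmt-SmoothPoincare4-15190): the planar family (E3), A.2 — the ambient isotopy `Φ_t`

Support file (`--supports` stmt-SmoothPoincare4-15190) of the homothety-cover proof of the genus-one
clause (E) of Griffiths' handlebody extension theorem — *every self-diffeomorphism of the Heegaard torus
`∂V` of the round solid torus fixing the base point and acting trivially on `π₁(∂V)` extends to a
self-diffeomorphism of `V`* (hypothesis `hE` of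
`Literature.Topology.FourManifolds.RoundSolidTorusModel.diffeoExtends_of_map_ker_eq_ker_of_forall_diffeoExtends`).
See the module docstring of `…CoverDefs` for the whole line (E1–E6) and the notation
(`τ̂`, `δ_λ`, `ρ`, `χ`, `f`, `Δ^(c)`, `α`, `L`, `M`, `Ψ̂`, `ẽ_c`).

This part (E3-A, second half): cutting `V` off in time and radius gives a compactly supported smooth time-dependent
field `G`; its flow (`SlabFlow.exists_ambientIsotopy_of_timeDependent_of_isCompact`) is an ambient isotopy `Φ_t` of
the plane with `Φ_t ∘ τ = S_t` on the annulus `A = {1/2 ≤ ‖u‖ ≤ 2}` for `t ∈ (-1, 2)` (`PI.exists_isotopy`).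
-/

-- the registered namespace `Summit.SmoothPoincare4.SmoothPoincare4.Theorems` repeats a component
set_option linter.dupNamespace false

noncomputable section

namespace Summit.SmoothPoincare4.SmoothPoincare4.Theorems

namespace HomothetyCover

open Set Function Metric Filter
open scoped Topology ContDiff

namespace Planar

open Set Function Metric Filter
open scoped Topology ContDiff Manifold
open Literature.Topology.FourManifolds
attribute [local instance] factFinrankE2
variable {lam : ℝ} (P : PI lam)

namespace PI

/-! ### Cut-offs -/

/-- Time cut-off: `1` on `[-1, 2]`, `0` off `[-2, 3]`. -/
def χT (t : ℝ) : ℝ := Real.smoothTransition (t + 2) * Real.smoothTransition (3 - t)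

/-- The time cut-off is `1` on `[-1, 2]`. -/
theorem χT_of_mem {t : ℝ} (ht : t ∈ Icc (-1 : ℝ) 2) : χT t = 1 := by
  rw [χT, Real.smoothTransition.one_of_one_le (by linarith [ht.1]),
    Real.smoothTransition.one_of_one_le (by linarith [ht.2]), one_mul]

/-- The time cut-off vanishes off `[-2, 3]`. -/
theorem χT_of_not_mem {t : ℝ} (ht : t ∉ Icc (-2 : ℝ) 3) : χT t = 0 := by
  rw [mem_Icc, not_and_or, not_le, not_le] at ht
  rcases ht with h | h
  · rw [χT, Real.smoothTransition.zero_of_nonpos (by linarith), zero_mul]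
  · rw [χT, Real.smoothTransition.zero_of_nonpos (x := 3 - t) (by linarith), mul_zero]

/-- The time cut-off is smooth. -/
theorem contDiff_χT : ContDiff ℝ ∞ χT :=
  (Real.smoothTransition.contDiff.comp (contDiff_id.add contDiff_const)).mul
    (Real.smoothTransition.contDiff.comp (contDiff_const.sub contDiff_id))

/-- Radial plateau: `1` for `r₁² ≤ ‖w‖² ≤ r₂²`, `0` for `‖w‖² ≤ r₁²/4` and for `4 r₂² ≤ ‖w‖²`. -/
def βcut (r₁ r₂ : ℝ) (w : E2) : ℝ :=
  Real.smoothTransition ((‖w‖ ^ 2 - r₁ ^ 2 / 4) / (r₁ ^ 2 - r₁ ^ 2 / 4)) *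
    Real.smoothTransition ((4 * r₂ ^ 2 - ‖w‖ ^ 2) / (4 * r₂ ^ 2 - r₂ ^ 2))

/-- The radial cut-off is `1` on the annulus `r₁ ≤ ‖w‖ ≤ r₂`. -/
theorem βcut_of_mem {r₁ r₂ : ℝ} (h₁ : 0 < r₁) (h₂ : 0 < r₂) {w : E2} (hw₁ : r₁ ≤ ‖w‖) (hw₂ : ‖w‖ ≤ r₂) :
    βcut r₁ r₂ w = 1 := by
  have e1 : 1 ≤ (‖w‖ ^ 2 - r₁ ^ 2 / 4) / (r₁ ^ 2 - r₁ ^ 2 / 4) := by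
    rw [le_div_iff₀ (by nlinarith)]; nlinarith
  have e2 : 1 ≤ (4 * r₂ ^ 2 - ‖w‖ ^ 2) / (4 * r₂ ^ 2 - r₂ ^ 2) := by
    rw [le_div_iff₀ (by nlinarith)]; nlinarith [norm_nonneg w]
  rw [βcut, Real.smoothTransition.one_of_one_le e1, Real.smoothTransition.one_of_one_le e2, one_mul]

/-- The radial cut-off vanishes on `‖w‖ ≤ r₁/2`. -/
theorem βcut_of_small {r₁ r₂ : ℝ} {w : E2} (hw : ‖w‖ ^ 2 ≤ r₁ ^ 2 / 4) :
    βcut r₁ r₂ w = 0 := by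
  have e1 : (‖w‖ ^ 2 - r₁ ^ 2 / 4) / (r₁ ^ 2 - r₁ ^ 2 / 4) ≤ 0 :=
    div_nonpos_of_nonpos_of_nonneg (by linarith) (by nlinarith)
  rw [βcut, Real.smoothTransition.zero_of_nonpos e1, zero_mul]

/-- The radial cut-off vanishes on `‖w‖ ≥ 2r₂`. -/
theorem βcut_of_large {r₁ r₂ : ℝ} {w : E2} (hw : 4 * r₂ ^ 2 ≤ ‖w‖ ^ 2) :
    βcut r₁ r₂ w = 0 := by
  have e2 : (4 * r₂ ^ 2 - ‖w‖ ^ 2) / (4 * r₂ ^ 2 - r₂ ^ 2) ≤ 0 :=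
    div_nonpos_of_nonpos_of_nonneg (by linarith) (by nlinarith)
  rw [βcut, Real.smoothTransition.zero_of_nonpos e2, mul_zero]

/-- The radial cut-off is smooth. -/
theorem contDiff_βcut (r₁ r₂ : ℝ) : ContDiff ℝ ∞ (βcut r₁ r₂) :=
  (Real.smoothTransition.contDiff.comp (((contDiff_norm_sq ℝ).sub contDiff_const).div_const _)).mul
    (Real.smoothTransition.contDiff.comp ((contDiff_const.sub (contDiff_norm_sq ℝ)).div_const _))

/-! ### The cut-off field `G = (χT · β) • V` and its flow -/

/-- The cut-off time-dependent field. -/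
def G (r₁ r₂ : ℝ) (p : ℝ × E2) : E2 := (χT p.1 * βcut r₁ r₂ p.2) • P.V p

/-- The cut-off time-dependent field `G` is smooth everywhere (it vanishes near the origin). -/
theorem contDiff_G {r₁ r₂ : ℝ} (h₁ : 0 < r₁) : ContDiff ℝ ∞ (P.G r₁ r₂) := by
  rw [contDiff_iff_contDiffAt]
  rintro ⟨t, w⟩
  by_cases hw : w = 0
  · -- near `(t, 0)` the field vanishes identically
    subst hw
    have hopen : IsOpen {p : ℝ × E2 | ‖p.2‖ ^ 2 < r₁ ^ 2 / 4} :=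
      isOpen_lt ((continuous_norm.comp continuous_snd).pow 2) continuous_const
    have hmem : ((t, (0 : E2)) : ℝ × E2) ∈ {p : ℝ × E2 | ‖p.2‖ ^ 2 < r₁ ^ 2 / 4} := by
      show ‖(0 : E2)‖ ^ 2 < r₁ ^ 2 / 4; rw [norm_zero, zero_pow two_ne_zero]
      have := h₁; positivity
    refine (contDiffAt_const (c := (0 : E2))).congr_of_eventuallyEq ?_
    filter_upwards [hopen.mem_nhds hmem] with p hp
    simp only [G, βcut_of_small (le_of_lt hp), mul_zero, zero_smul]
  · exact ((contDiff_χT.contDiffAt.comp _ contDiffAt_fst).mul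
      ((contDiff_βcut r₁ r₂).contDiffAt.comp _ contDiffAt_snd)).smul (P.contDiffAt_V hw)

/-- `G` vanishes for times outside `[-2, 3]`. -/
theorem G_eq_zero_of_time {r₁ r₂ : ℝ} {p : ℝ × E2} (hp : p.1 ∉ Icc (-2 : ℝ) 3) : P.G r₁ r₂ p = 0 := by
  simp [G, χT_of_not_mem hp]

/-- `G` vanishes outside the ball of radius `2r₂`. -/
theorem G_eq_zero_of_large {r₁ r₂ : ℝ} (h₂ : 0 < r₂) {p : ℝ × E2} (hp : 2 * r₂ ≤ ‖p.2‖) :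
    P.G r₁ r₂ p = 0 := by
  have : 4 * r₂ ^ 2 ≤ ‖p.2‖ ^ 2 := by nlinarith [norm_nonneg p.2]
  simp [G, βcut_of_large this]

/-- The field as a smooth time-dependent vector field on the manifold `E2`. -/
theorem contMDiff_G_bundle {r₁ r₂ : ℝ} (h₁ : 0 < r₁) :
    ContMDiff (𝓘(ℝ, ℝ).prod 𝓘(ℝ, E2)) 𝓘(ℝ, E2).tangent ∞
      fun p : ℝ × E2 => (⟨p.2, P.G r₁ r₂ p⟩ : TangentBundle 𝓘(ℝ, E2) E2) := by
  have hGm : ContMDiff (𝓘(ℝ, ℝ).prod 𝓘(ℝ, E2)) 𝓘(ℝ, E2) ∞ (P.G r₁ r₂) :=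
    (P.contDiff_G h₁).comp_contMDiff (contMDiff_fst.prodMk_space contMDiff_snd)
  intro p
  rw [ModelWithCorners.tangent, Bundle.contMDiffAt_totalSpace]
  refine ⟨contMDiffAt_snd, ?_⟩
  simp only [trivializationAt_model_space_apply]
  exact hGm p

/-! ### Bounds on the annulus tracks -/

/-- The source annulus `A = {1/2 ≤ ‖u‖ ≤ 2}`. -/
def ann : Set E2 := {u | 1 / 2 ≤ ‖u‖ ∧ ‖u‖ ≤ 2}

/-- The annulus `A = {1/2 ≤ ‖u‖ ≤ 2}` is compact. -/
theorem isCompact_ann : IsCompact ann := by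
  have : ann = closedBall (0 : E2) 2 ∩ {u | 1 / 2 ≤ ‖u‖} := by
    ext u; simp [ann, and_comm]
  rw [this]
  exact (isCompact_closedBall _ _).inter_right (isClosed_le continuous_const continuous_norm)

/-- The annulus misses the origin. -/
theorem ne_zero_of_mem_ann {u : E2} (hu : u ∈ ann) : u ≠ 0 := by
  intro h; rw [h] at hu; obtain ⟨h1, -⟩ := hu; rw [norm_zero] at h1; linarith

/-- **Uniform bounds**: `r₁ ≤ ‖S t u‖ ≤ r₂` for `t ∈ [-1, 2]`, `u ∈ A`, with `0 < r₁`. -/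
theorem exists_bounds_S : ∃ r₁ r₂ : ℝ, 0 < r₁ ∧ 0 < r₂ ∧
    ∀ t ∈ Icc (-1 : ℝ) 2, ∀ u ∈ ann, r₁ ≤ ‖P.S t u‖ ∧ ‖P.S t u‖ ≤ r₂ := by
  have hK : IsCompact (Icc (-1 : ℝ) 2 ×ˢ ann) := isCompact_Icc.prod isCompact_ann
  have hcont : ContinuousOn (fun p : ℝ × E2 => ‖uncurry P.S p‖) (Icc (-1 : ℝ) 2 ×ˢ ann) := by
    intro p hp
    exact ((P.contDiffAt_S (ne_zero_of_mem_ann hp.2)).continuousAt.norm).continuousWithinAt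
  have hne : (Icc (-1 : ℝ) 2 ×ˢ ann).Nonempty := by
    set u₀ : E2 := EuclideanSpace.single (0 : Fin 2) (1 : ℝ) with hu₀
    have hn : ‖u₀‖ = 1 := by rw [hu₀]; simp
    refine ⟨((0 : ℝ), u₀), ⟨by norm_num, by norm_num⟩, ?_⟩
    show 1 / 2 ≤ ‖u₀‖ ∧ ‖u₀‖ ≤ 2
    rw [hn]; norm_num
  obtain ⟨pmin, hpmin, hmin⟩ := hK.exists_isMinOn hne hcont
  obtain ⟨pmax, hpmax, hmax⟩ := hK.exists_isMaxOn hne hcont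
  rw [isMinOn_iff] at hmin
  rw [isMaxOn_iff] at hmax
  refine ⟨‖uncurry P.S pmin‖, max ‖uncurry P.S pmax‖ 1, ?_, by positivity, fun t ht u hu => ⟨?_, ?_⟩⟩
  · exact norm_pos_iff.2 (P.S_ne_zero _ (ne_zero_of_mem_ann hpmin.2))
  · exact hmin (t, u) ⟨ht, hu⟩
  · exact (hmax (t, u) ⟨ht, hu⟩).trans (le_max_left _ _)

/-- **Part A.**  An ambient isotopy `Φ_t` of the plane, jointly smooth with jointly smooth
inverses, `Φ_0 = id`, with `Φ_t (τ u) = S t u` for `t ∈ (-1, 2)` and `1/2 ≤ ‖u‖ ≤ 2`. -/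
theorem exists_isotopy : ∃ Φ Φ' : ℝ → E2 → E2,
    ContDiff ℝ ∞ (uncurry Φ) ∧ ContDiff ℝ ∞ (uncurry Φ') ∧
    (∀ t w, Φ' t (Φ t w) = w) ∧ (∀ t w, Φ t (Φ' t w) = w) ∧ (∀ w, Φ 0 w = w) ∧
    (∀ t ∈ Ioo (-1 : ℝ) 2, ∀ u ∈ ann, Φ t (P.τ u) = P.S t u) := by
  obtain ⟨r₁, r₂, h₁, h₂, hbd⟩ := P.exists_bounds_S
  have hGb := P.contMDiff_G_bundle (r₂ := r₂) h₁
  have hsupp : ∀ p : ℝ × E2, (p.1 ∉ Icc (-2 : ℝ) 3 ∨ p.2 ∉ closedBall (0 : E2) (2 * r₂)) →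
      P.G r₁ r₂ p = 0 := by
    rintro p (hp | hp)
    · exact P.G_eq_zero_of_time hp
    · rw [mem_closedBall, dist_zero_right, not_le] at hp
      exact P.G_eq_zero_of_large h₂ hp.le
  obtain ⟨Ψ, hΨ⟩ := SlabFlow.exists_ambientIsotopy_of_timeDependent_of_isCompact
    (J := 𝓘(ℝ, E2)) (N := E2) (a := -2) (b := 3) hGb (isCompact_closedBall 0 (2 * r₂)) hsupp
  -- joint smoothness of stages and inverse stages as maps of `ℝ × E2`
  have hid : ContMDiff 𝓘(ℝ, ℝ × E2) (𝓘(ℝ, ℝ).prod 𝓘(ℝ, E2)) ∞ (fun p : ℝ × E2 => (p.1, p.2)) :=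
    (contMDiff_iff_contDiff.2 contDiff_fst).prodMk (contMDiff_iff_contDiff.2 contDiff_snd)
  have hΦ : ContDiff ℝ ∞ (uncurry Ψ.toFun) := by
    have h := Ψ.contMDiff.comp hid
    exact contMDiff_iff_contDiff.1 h
  have hΦ' : ContDiff ℝ ∞ (uncurry fun t y => (Ψ.toDiffeomorph t).symm y) := by
    have h := Ψ.contMDiff_uncurry_symm.comp hid
    exact contMDiff_iff_contDiff.1 h
  refine ⟨Ψ.toFun, fun t y => (Ψ.toDiffeomorph t).symm y, hΦ, hΦ', fun t w => ?_, fun t w => ?_,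
    fun w => ?_, fun t ht u hu => ?_⟩
  · exact (Ψ.toDiffeomorph t).symm_apply_apply w
  · exact (Ψ.toDiffeomorph t).apply_symm_apply w
  · rw [Ψ.map_zero]; rfl
  · -- the explicit track `s ↦ S s u` is an integral curve on `(-1, 2)`
    have hu0 : u ≠ 0 := ne_zero_of_mem_ann hu
    have h0 : (0 : ℝ) ∈ Ioo (-1 : ℝ) 2 := by constructor <;> norm_num
    have htrack : IsMIntegralCurveOn (I := 𝓘(ℝ, ℝ).prod 𝓘(ℝ, E2)) (fun s => ((s, P.S s u) : ℝ × E2))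
        (fun p : ℝ × E2 => (((1 : ℝ), P.G r₁ r₂ p) : TangentSpace (𝓘(ℝ, ℝ).prod 𝓘(ℝ, E2)) p))
        (Ioo (-1 : ℝ) 2) := by
      intro s hs
      have hGv : P.G r₁ r₂ (s, P.S s u) = P.V (s, P.S s u) := by
        obtain ⟨hb1, hb2⟩ := hbd s (Ioo_subset_Icc_self hs) u hu
        rw [G, χT_of_mem (Ioo_subset_Icc_self hs), βcut_of_mem h₁ h₂ hb1 hb2, one_mul, one_smul]
      have e1 : HasMFDerivAt 𝓘(ℝ, ℝ) 𝓘(ℝ, ℝ) (fun s : ℝ => s) s (ContinuousLinearMap.id ℝ ℝ) := by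
        rw [hasMFDerivAt_iff_hasFDerivAt]; exact hasFDerivAt_id s
      have e2 : HasMFDerivAt 𝓘(ℝ, ℝ) 𝓘(ℝ, E2) (fun s => P.S s u) s
          ((1 : ℝ →L[ℝ] ℝ).smulRight (P.V (s, P.S s u))) := by
        rw [hasMFDerivAt_iff_hasFDerivAt]; exact (P.hasDerivAt_S hu0 s).hasFDerivAt
      have hL : ((1 : ℝ →L[ℝ] ℝ).smulRight
          ((fun p : ℝ × E2 => (((1 : ℝ), P.G r₁ r₂ p) : TangentSpace (𝓘(ℝ, ℝ).prod 𝓘(ℝ, E2)) p))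
            (s, P.S s u)) :
          TangentSpace 𝓘(ℝ, ℝ) s →L[ℝ] TangentSpace (𝓘(ℝ, ℝ).prod 𝓘(ℝ, E2)) (s, P.S s u)) =
          (ContinuousLinearMap.id ℝ ℝ).prod ((1 : ℝ →L[ℝ] ℝ).smulRight (P.V (s, P.S s u))) := by
        apply ContinuousLinearMap.ext
        intro a
        refine Prod.ext ?_ ?_
        · change (a • (((1 : ℝ), P.G r₁ r₂ (s, P.S s u)) : ℝ × E2)).1 = a
          simp
        · change (a • (((1 : ℝ), P.G r₁ r₂ (s, P.S s u)) : ℝ × E2)).2 = a • P.V (s, P.S s u)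
          rw [Prod.smul_snd, hGv]
      have e12 := e1.prodMk e2
      show HasMFDerivWithinAt 𝓘(ℝ, ℝ) (𝓘(ℝ, ℝ).prod 𝓘(ℝ, E2)) (fun s => ((s, P.S s u) : ℝ × E2))
        (Ioo (-1 : ℝ) 2) s
        ((1 : ℝ →L[ℝ] ℝ).smulRight
          ((fun p : ℝ × E2 => (((1 : ℝ), P.G r₁ r₂ p) : TangentSpace (𝓘(ℝ, ℝ).prod 𝓘(ℝ, E2)) p))
            (s, P.S s u)))
      rw [hL]
      exact e12.hasMFDerivWithinAt
    have := SlabFlow.apply_eq_of_track hGb hΨ h0 htrack ht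
    rw [P.S_zero] at this
    exact this.symm

end PI

end Planar

end HomothetyCover

end Summit.SmoothPoincare4.SmoothPoincare4.Theorems

end
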